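import Summits.CriticalPhenomena.PercolationContinuityZ3.Theorems.PercNearOneGluingNoHeavyLowerTailSahiE3HittingEvents
import Summits.CriticalPhenomena.PercolationContinuityZ3.Theorems.SahiInfiniteVolumeCylinderEvents
import HarnessLib

/-!
# `NoHeavyLowerTail` (crux stmt-CriticalPhenomena-4575), Sahi programme P5: Kahn's Conjecture 5 for all triples of
# DEPTH-ONE monotone events (each a conjunction `{F ⊆ ω}` or a disjunction `{ω ∩ S ≠ ∅}` of coordinates), any product space

Support file (seat `prim-l12-p5`, gen 6; `--supports stmt-CriticalPhenomena-4575`).  Proofs only; no definitions, no named facts, no sorries;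
standard axioms.  Packaging of two tree theorems into one statement about the smallest natural class of increasing events beyond single
coordinates — the DEPTH-ONE events of `prodBernoulli p` on `Set ι` (monotone Boolean formulas of depth one in the coordinates):

* cylinders `C_F = {ω | ↑F ⊆ ω}` ("every coordinate of `F` present", conjunction) — any slot a cylinder: the tree's unconditional instance of
  Sahi's Theorem 2 / Blinovsky in infinite volume, `SahiInfiniteVolume.sahiE3_prodBernoulli_cylinder_nonneg` [Sahi2008, Thm. 2; Blinovsky2013];
* hitting events `H_S = {ω | ∃ i ∈ S, i ∈ ω}` ("some coordinate of `S` present", disjunction) — all three slots hitting events: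
  `SahiHitting.prodBernoulli_sahiE3_hit_nonneg` (this seat, gen 6).

`prodBernoulli_sahiE3_depthOne_nonneg`: for every index type `ι`, every `p : ι → [0,1]`, all finite `A, B, C ⊆ ι` and every choice of
connective per slot (`Bool`: `true` = conjunction, `false` = disjunction), `0 ≤ E₃`.  So Kahn's Conjecture 5 [Kahn2022, Conj. 5] holds on the
whole depth-one class; the first open depth is two (e.g. a CNF slot `(x₁ ∨ x₂) ∧ x₃` against two disjunctions).
[cite: Kahn2022, Conj. 5 (arXiv p. 3); Sahi2008, Thm. 2 and Conj. 5; Blinovsky2013]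
-/

namespace Summit.CriticalPhenomena.PercolationContinuityZ3.Theorems

namespace SahiHitting

open MeasureTheory Literature.Probability.LatticeModels

variable {ι : Type*}

/-- Hitting events are increasing. [folklore] -/
theorem isUpperSet_hit (S : Finset ι) : IsUpperSet {ω : Set ι | ∃ i ∈ S, i ∈ ω} :=
  fun _ _ hle ⟨i, hiS, hi⟩ => ⟨i, hiS, hle hi⟩

/-- Hitting events of finite sets are measurable. [folklore] -/
theorem measurableSet_hit (S : Finset ι) : MeasurableSet {ω : Set ι | ∃ i ∈ S, i ∈ ω} := by
  rw [hit_eq_compl_miss]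
  exact (SahiInfiniteVolume.measurableSet_disjoint_finset S).compl

/-- Cylinder events are increasing. [folklore] -/
theorem isUpperSet_cyl (F : Finset ι) : IsUpperSet {ω : Set ι | (↑F : Set ι) ⊆ ω} :=
  fun _ _ hle hF => hF.trans hle

/-- The depth-one event of a finite coordinate set: conjunction (`true`) or disjunction (`false`); it is increasing. [folklore] -/
theorem isUpperSet_depthOne (b : Bool) (S : Finset ι) :
    IsUpperSet (cond b {ω : Set ι | (↑S : Set ι) ⊆ ω} {ω : Set ι | ∃ i ∈ S, i ∈ ω}) := by
  cases b
  · exact isUpperSet_hit S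
  · exact isUpperSet_cyl S

/-- Depth-one events are measurable. [folklore] -/
theorem measurableSet_depthOne (b : Bool) (S : Finset ι) :
    MeasurableSet (cond b {ω : Set ι | (↑S : Set ι) ⊆ ω} {ω : Set ι | ∃ i ∈ S, i ∈ ω}) := by
  cases b
  · exact measurableSet_hit S
  · exact SahiInfiniteVolume.measurableSet_supset_finset S

/-- A cylinder in the first slot against two depth-one events. [cite: Sahi2008, Thm. 2; Blinovsky2013] -/
theorem prodBernoulli_sahiE3_cyl_depthOne_nonneg (p : ι → unitInterval) (F : Finset ι) (b c : Bool) (B C : Finset ι) :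
    0 ≤ sahiE3 (prodBernoulli p) {ω : Set ι | (↑F : Set ι) ⊆ ω}
      (cond b {ω : Set ι | (↑B : Set ι) ⊆ ω} {ω : Set ι | ∃ i ∈ B, i ∈ ω})
      (cond c {ω : Set ι | (↑C : Set ι) ⊆ ω} {ω : Set ι | ∃ i ∈ C, i ∈ ω}) :=
  SahiInfiniteVolume.sahiE3_prodBernoulli_cylinder_nonneg p F (isUpperSet_depthOne b B) (isUpperSet_depthOne c C)
    (measurableSet_depthOne b B) (measurableSet_depthOne c C)

/-- **Kahn's Conjecture 5 on the depth-one class**: for every index type `ι`, every `p : ι → [0,1]`, all finite `A, B, C ⊆ ι`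
and all connectives `a, b, c` (`true` = "all coordinates present", `false` = "some coordinate present"),
`0 ≤ E₃` of the three depth-one events under `prodBernoulli p`. [this work; cite: Kahn2022, Conj. 5 (arXiv p. 3)] -/
theorem prodBernoulli_sahiE3_depthOne_nonneg (p : ι → unitInterval) (a b c : Bool) (A B C : Finset ι) :
    0 ≤ sahiE3 (prodBernoulli p)
      (cond a {ω : Set ι | (↑A : Set ι) ⊆ ω} {ω : Set ι | ∃ i ∈ A, i ∈ ω})
      (cond b {ω : Set ι | (↑B : Set ι) ⊆ ω} {ω : Set ι | ∃ i ∈ B, i ∈ ω})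
      (cond c {ω : Set ι | (↑C : Set ι) ⊆ ω} {ω : Set ι | ∃ i ∈ C, i ∈ ω}) := by
  cases a
  · cases b
    · cases c
      · exact prodBernoulli_sahiE3_hit_nonneg p A B C
      · -- (hit, hit, cyl): move the cylinder to the front
        rw [sahiE3_comm₂₃, sahiE3_comm₁₂]
        exact prodBernoulli_sahiE3_cyl_depthOne_nonneg p C false false A B
    · -- (hit, cyl, ·): swap the first two slots
      rw [sahiE3_comm₁₂]
      exact prodBernoulli_sahiE3_cyl_depthOne_nonneg p B false c A C
  · exact prodBernoulli_sahiE3_cyl_depthOne_nonneg p A b c B C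

end SahiHitting

end Summit.CriticalPhenomena.PercolationContinuityZ3.Theorems
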